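import Summits.BirchSwinnertonDyer.BirchSwinnertonDyer.Theorems.QuadraticBranchSignedControlPlusEtaNonsurjPrimeLFunction
import Summits.BirchSwinnertonDyer.Rank1Residual.Additive.QuadraticBranchEvenValueIdentity
import Summits.BirchSwinnertonDyer.Rank1Residual.Additive.CensusX41Calibration
import Literature.NumberTheory.EllipticCurves.AnalyticRankWindow
import HarnessLib

/-!
# Route `QuadraticBranchSignedControl` (rung K8, cell `bsd-potss`), residual crux
# `PlusEtaMainConjectureNonsurj` (stmt-BirchSwinnertonDyer-19606): the SHAPE binder `(L_p⁺(V,η,X)) = (X)` of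
# the rank-`1` sub-cut (`stub_etaMC_r1_mu`, skeleton v4) SPLIT into `L(W,1) = 0` (a THEOREM from `r_an(W) = 1`)
# and ONE `p`-adic unit coefficient (seat `bsd-potss-k8eta-c2` g5, file 2; seat g4's follow-up (iii))

WHAT. Skeleton v4 of crux 19606 (planner g22) cuts the rank-`1` rows on seat g4's PRIME-`L`-FUNCTION ROAD
(`EtaPrimeRoad`, p508939): (C1⁺_η)(V,p) ⟸ `μ(X⁺(V/K_∞)^η) = 0` on the binders «`r_an(W) = 1` and
`(L_p⁺(V,η,X)) = (X)` for every plus `L`-function of the newform of `V`» — the second a DISPLAYED analytic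
input standing for PARI's `(λ, μ) = (1, 0)` together with `L_p⁺(V,η,0) = 0`. This file proves that the
vanishing half of that input is NOT an input:

* §1 (`Λ`-algebra) `span_eq_span_X_of_constantCoeff_eq_zero_of_isUnit_coeff_one`: in `Λ = ℤ_p⟦X⟧`,
  `L(0) = 0` and `coeff₁ L ∈ ℤ_p^×` give `(L) = (X)`; conversely `(L) = (X)` gives both
  (`constantCoeff_eq_zero_and_isUnit_coeff_one_of_span_eq_span_X`). So «`(L) = (X)`» ⟺ «`L(0) = 0` ∧
  `coeff₁ L` is a unit» — the latter conjunct is `(λ, μ) = (1, 0)` given the former.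
* §2 (the value) **`constantCoeff_eq_zero_of_entireLFunction_one_eq_zero`**: for `W` globally minimal, the
  `p*`-twist partner of a globally minimal curve `V` good at the odd prime `p` (`C • W^{(p*)} = V`), `f` the
  newform of `V`, `ϖ` the period ratio of the parity of `η`, and ANY `L` with
  `IsQuadraticBranchPlusLFunction f p ϖ L`: **`L(W,1) = 0 ⟹ L(0) = 0`** — Kobayashi's (3.6)
  (`IsQuadraticBranchPlusLFunction.constantCoeff`: `L(0) = −u·ϖ·∑_{a mod p}(a/p)[a/p]^δ_f`, `u ∈ ℤ_p^×`)
  against Birch's formula for the twist (the tree's `legendre{Plus,Minus}SymbolSum_eq_zero_of_entireLFunction_one_eq_zero`: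
  `L(W,1) = ϖ·S^δ·Ω_W[/c_∞]`, so `L(W,1) = 0 ⟹ S^δ = 0`). Modularity (`hmod`) is the only named input. The
  companion `valuation_constantCoeff_eq_padicValRat_of_twist` (ctrl g2) gives `v_p(L(0)) = v_p(L(W,1)/Ω_W)`
  but is silent when `L(W,1) = 0` (`v_p(0) = 0` by convention); this is the missing vanishing statement.
  `constantCoeff_eq_zero_of_analyticRank_ne_zero`: the same from `r_an(W) ≠ 0`.
* §3 (the sub-cut re-read) `span_eq_span_X_of_analyticRank_ne_zero_of_isUnit_coeff_one`: on a row with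
  `r_an(W) ≠ 0`, the v4 shape binder FOLLOWS from the smaller displayed input «`coeff₁ Lη ∈ ℤ_p^×` for every
  plus `L`-function» (`IsUnit (PowerSeries.coeff 1 Lη)`; choice-free: two interpolants differ by a unit of
  `ℤ_p`); and **`etaMC_rankOneRows_of_mu_eq_zero_of_isUnit_coeff_one`** = seat g4's ∀-form
  `EtaPrimeRoad.etaMC_rankOneRows_of_mu_eq_zero_of_span_eq_span_X` with the shape binder so replaced:
  (C1⁺_η)(V,p) on «`p ≥ 5`, `C • W^{(p*)} = V`, good, `a_p = 0`, `r_an(W) = 1`, `coeff₁ L_p⁺(V,η,X) ∈ ℤ_p^×`,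
  `μ(X⁺(V/K_∞)^η) = 0`» modulo `h22`, `h41`, `hGZK`, `hmod`. In PARI's census (seat g3, 290 rank-`1`
  non-onto pairs below `5·10⁵`, `p = 5`) the unit-coefficient input is `λ⁺ = 1` (254 rows); it is a
  `p`-adic NUMERICAL input (Pollack's `L_p⁺` to one digit), not kernel-checked.

HONEST FRAMING (cell `bsd-potss`; FULL-BSD rank ≤ 1 programme, HUMAN RULING D-0036/D-0074): BOOKKEEPING /
ALGEBRA THEOREMS ONLY — no definition, no new fact, no `sorry`, axioms standard; CONDITIONAL on the named
facts in hypothesis position where stated. Nothing is proved by name toward the stubs (the `μ = 0` input of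
`stub_etaMC_r1_mu` is untouched); 19606 stays OPEN; nothing is booked; no label / mark / count moves.
`--supports stmt-BirchSwinnertonDyer-19606`.

References: [Kobayashi2003] Thm. 3.2, (3.4), (3.6) (p. 7), §4 + Thm. 4.1 (p. 8); [MazurTateTeitelbaum1986Invent]
§I.8 (8.6); [Pal2012] Thm. 3.2; [Washington1997] §7.1 (units and distinguished polynomials of `Λ`);
[CremonaAlgorithms1997] §2.13; [GreenbergVatsal2000] p. 2 (2).
-/

set_option autoImplicit false
set_option linter.dupNamespace false

noncomputable section

open scoped Classical

open CongruenceSubgroup Field Function NumberField IsDedekindDomain WeierstrassCurve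
open Literature.NumberTheory.EllipticCurves
open Literature.NumberTheory.EllipticCurves.ModularForms
open Literature.NumberTheory.EllipticCurves.Rank1Residual
open Literature.NumberTheory.EllipticCurves.Rank1Residual.Typed
open Literature.NumberTheory.GaloisRepresentations
open Literature.NumberTheory.GaloisCohomology
open Literature.NumberTheory.EllipticCurves.IwasawaAlgebra
open Literature.NumberTheory.EllipticCurves.IwasawaDual ZpExtension
open Literature.NumberTheory.EllipticCurves.GreenbergVatsal2000
open Summit.BirchSwinnertonDyer.Rank1Residual.X11b.Levels
open Summit.BirchSwinnertonDyer.Rank1Residual.X11b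
open Summit.BirchSwinnertonDyer.Rank1Residual.Additive
open Summit.BirchSwinnertonDyer.Rank1Residual.Additive.SignedTwist
open scoped ContRepresentation
open Summit.BirchSwinnertonDyer.Rank1Residual.AdditivePotMult

namespace Summit.BirchSwinnertonDyer.BirchSwinnertonDyer.Theorems

namespace EtaPrimeRoad

/-! ## §1 `Λ`-algebra: `(L) = (X)` ⟺ `L(0) = 0` and `coeff₁ L ∈ ℤ_p^×` -/

section Algebra

variable {p : ℕ} [hp : Fact p.Prime]

/-- **`L(0) = 0` and `coeff₁ L ∈ ℤ_p^×` ⟹ `(L) = (X)` in `Λ = ℤ_p⟦X⟧`.** `L(0) = 0` gives `L = X·L'`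
(`PowerSeries.X_dvd_iff`), `L'(0) = coeff₁ L` is a unit so `L'` is a unit of `Λ`
(`PowerSeries.isUnit_iff_constantCoeff`), and `(X·L') = (X)`. The shape `(λ, μ) = (1, 0)` with `L(0) = 0`.
[cite: Washington1997, §7.1] -/
theorem span_eq_span_X_of_constantCoeff_eq_zero_of_isUnit_coeff_one {L : IwasawaAlgebra p}
    (h0 : PowerSeries.constantCoeff L = 0) (h1 : IsUnit (PowerSeries.coeff 1 L)) :
    Ideal.span ({L} : Set (IwasawaAlgebra p)) = Ideal.span {PowerSeries.X} := by
  obtain ⟨L', hL'⟩ := (PowerSeries.X_dvd_iff (φ := L)).mpr h0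
  have hc : PowerSeries.constantCoeff L' = PowerSeries.coeff 1 L := by
    rw [hL', ← PowerSeries.coeff_zero_eq_constantCoeff_apply, PowerSeries.coeff_succ_X_mul]
  have hu : IsUnit L' := PowerSeries.isUnit_iff_constantCoeff.mpr (hc ▸ h1)
  rw [hL']
  exact Ideal.span_singleton_mul_right_unit hu PowerSeries.X

/-- **Conversely `(L) = (X)` ⟹ `L(0) = 0` and `coeff₁ L ∈ ℤ_p^×`**: `L = X·v` for a unit `v` of `Λ`, so
`L(0) = 0` and `coeff₁ L = v(0) ∈ ℤ_p^×`. [cite: Washington1997, §7.1] -/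
theorem constantCoeff_eq_zero_and_isUnit_coeff_one_of_span_eq_span_X {L : IwasawaAlgebra p}
    (h : Ideal.span ({L} : Set (IwasawaAlgebra p)) = Ideal.span {PowerSeries.X}) :
    PowerSeries.constantCoeff L = 0 ∧ IsUnit (PowerSeries.coeff 1 L) := by
  obtain ⟨v, hv⟩ := Ideal.span_singleton_eq_span_singleton.mp h.symm
  -- `hv : X * v = L`
  have hL : L = PowerSeries.X * (v : IwasawaAlgebra p) := hv.symm
  refine ⟨?_, ?_⟩
  · rw [hL, map_mul, PowerSeries.constantCoeff_X, zero_mul]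
  · rw [hL, PowerSeries.coeff_succ_X_mul, PowerSeries.coeff_zero_eq_constantCoeff_apply]
    exact PowerSeries.isUnit_iff_constantCoeff.mp (Units.isUnit v)

/-- **`(L) = (X)` ⟺ `L(0) = 0 ∧ coeff₁ L ∈ ℤ_p^×`** — the displayed shape binder of skeleton v4's
`stub_etaMC_r1_mu` as a conjunction of a VALUE statement and a unit-coefficient statement.
[cite: Washington1997, §7.1] -/
theorem span_eq_span_X_iff_constantCoeff_eq_zero_and_isUnit_coeff_one {L : IwasawaAlgebra p} :
    Ideal.span ({L} : Set (IwasawaAlgebra p)) = Ideal.span {PowerSeries.X} ↔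
      PowerSeries.constantCoeff L = 0 ∧ IsUnit (PowerSeries.coeff 1 L) :=
  ⟨constantCoeff_eq_zero_and_isUnit_coeff_one_of_span_eq_span_X,
    fun h ↦ span_eq_span_X_of_constantCoeff_eq_zero_of_isUnit_coeff_one h.1 h.2⟩

end Algebra

/-! ## §2 The value: `L(W,1) = 0 ⟹ L_p⁺(V,η,0) = 0` -/

section Value

variable (p : ℕ) [hp : Fact p.Prime] {N : ℕ} [NeZero N] {f : CuspForm (Gamma0 N) 2}

/-- **THE VANISHING HALF OF THE VALUE IDENTITY: `L(W,1) = 0 ⟹ L_p⁺(V, η, 0) = 0`.** For `W` globally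
minimal, the `p*`-twist partner of a globally minimal curve `V` good at the odd prime `p` (`C • W^{(p*)} = V`),
`f` the newform of `V`, `ϖ` the period ratio of the parity of `η`, and ANY `L ∈ Λ` with Kobayashi's plus
interpolation property on the quadratic branch: if `L(W,1) = 0` then `L(0) = 0` (so `X ∣ L`). Proof: (3.6)
reads `L(0) = −u·ϖ·S^δ` in `ℂ_p` with `u ∈ ℤ_p^×` and `S^δ = ∑_{a mod p}(a/p)[a/p]^δ_f ∈ ℚ`
(`IsQuadraticBranchPlusLFunction.constantCoeff` + `exists_orderOf_eq_two_and_forall_branchSum_eq`), while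
Birch's formula for the twist `W ≅ V^{(p*)}` (additive at `p`: `addv_of_twist_pStar`) gives
`L(W,1) = ϖ·S^δ·Ω_W` (`/c_∞` for `p ≡ 3 (4)`), whence `S^δ = 0`
(`legendre{Plus,Minus}SymbolSum_eq_zero_of_entireLFunction_one_eq_zero`). Modularity displayed (`hmod`).
[cite: Kobayashi2003, (3.6) (p. 7)] [cite: MazurTateTeitelbaum1986Invent, §I.8 (8.6)] [cite: Pal2012, Thm. 3.2] -/
theorem constantCoeff_eq_zero_of_entireLFunction_one_eq_zero (hmod : hasEntireLFunction_rat) (hp2 : p ≠ 2)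
    (W V : WeierstrassCurve ℚ) [W.IsElliptic] [W.IsGloballyMinimal] [V.IsElliptic] [V.IsGloballyMinimal]
    (C : VariableChange ℚ) (hCV : C • W.quadraticTwist ((-1) ^ (p / 2) * p) = V)
    (hgood : V.HasGoodReductionAtPrime p) (hf : IsNewformOf V f) {ϖ : ℚ}
    (hϖ : if Even (p / 2) then (ϖ : ℝ) * V.realPeriodRat = plusPeriod f
      else (ϖ : ℝ) * V.imaginaryPeriodRat = minusPeriod f)
    {L : IwasawaAlgebra p} (hL : IsQuadraticBranchPlusLFunction f p ϖ L)
    (hLW : W.entireLFunction 1 = 0) : PowerSeries.constantCoeff L = 0 := by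
  have hP : p.Prime := hp.out
  have hd : ((-1 : ℚ) ^ (p / 2) * p) ≠ 0 :=
    mul_ne_zero (pow_ne_zero _ (neg_ne_zero.mpr one_ne_zero)) (Nat.cast_ne_zero.mpr hP.ne_zero)
  haveI := W.isElliptic_quadraticTwist hd
  -- the twist read backwards, and `Addv W p`
  obtain ⟨C', hC'⟩ := exists_variableChange_quadraticTwist_symm (W := V) W hd ⟨C, hCV⟩
  have hjW : 0 ≤ padicValRat p W.j := by
    have htw : (W.quadraticTwist ((-1 : ℚ) ^ (p / 2) * p)).HasGoodReductionAtPrime p := by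
      rw [← hCV] at hgood
      exact (BSZLemma17.hasGoodReductionAtPrime_smul_iff _ C p).mp hgood
    exact padicValRat_j_nonneg_of_typeG W p (typeG_of_hasGoodReductionAtPrime_quadraticTwist W p hp2 htw)
  have hjV : 0 ≤ padicValRat p V.j := by
    have e : V.j = W.j := by subst hCV; rw [variableChange_j, j_quadraticTwist W hd]
    exact e ▸ hjW
  have hΔV : padicValInt p V.minimalDiscriminantInt < 6 := by
    rw [padicValInt.eq_zero_of_not_dvd (not_dvd_minimalDiscriminantInt_of_hasGoodReductionAtPrime' V p hgood)]
    norm_num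
  obtain ⟨hadd, -, -⟩ := addv_of_twist_pStar p hp2 V W hjV hΔV C' hC'
  -- Birch for the twist: `L(W,1) = 0` forces the signed Legendre symbol sum to vanish
  have hS : (if Even (p / 2) then legendrePlusSymbolSum f p else legendreMinusSymbolSum f p) = 0 := by
    by_cases hev : Even (p / 2)
    · have hp4 : p % 4 = 1 := (even_half_iff_mod_four p hp2).mp hev
      rw [if_pos hev] at hϖ ⊢
      have hC'' : C' • V.quadraticTwist (p : ℚ) = W := by rw [← hC', hev.neg_one_pow, one_mul]
      exact legendrePlusSymbolSum_eq_zero_of_entireLFunction_one_eq_zero p hmod hp4 V W C' hC''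
        (Or.inl hgood) hadd hf ϖ hϖ hLW
    · have hp4 : p % 4 = 3 := by
        have hodd : p % 2 = 1 := Nat.odd_iff.mp (hP.odd_of_ne_two hp2)
        have h := (even_half_iff_mod_four p hp2).not.mp hev
        omega
      rw [if_neg hev] at hϖ ⊢
      have hodd' : Odd (p / 2) := Nat.not_even_iff_odd.mp hev
      have hC'' : C' • V.quadraticTwist (-(p : ℚ)) = W := by rw [← hC', hodd'.neg_one_pow, neg_one_mul]
      exact legendreMinusSymbolSum_eq_zero_of_entireLFunction_one_eq_zero p hmod hp4 V W C' hC''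
        (Or.inl hgood) hadd hf ϖ hϖ hLW
  -- (3.6): `L(0) = −u ϖ S^δ` in `ℂ_p`, at the quadratic character of level `p^{0+1}`
  have he : cyclotomicExponent p = 1 := if_neg hp2
  obtain ⟨u, hu⟩ := hL.constantCoeff
  obtain ⟨⟨ψ, hψ⟩, hall⟩ :=
    exists_orderOf_eq_two_and_forall_branchSum_eq (f := f) hp2 (0 + 1) (by rw [he])
  have h1 := hu ψ hψ
  rw [hall ψ hψ, hS, Rat.cast_zero, mul_zero, neg_zero] at h1
  -- injectivity of `ℤ_p → ℚ_p → ℂ_p`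
  have h2 : algebraMap ℚ_[p] ℂ_[p] ((PowerSeries.constantCoeff L : ℤ_[p]) : ℚ_[p]) = 0 := h1
  rw [map_eq_zero_iff _ (algebraMap ℚ_[p] ℂ_[p]).injective] at h2
  exact PadicInt.coe_eq_zero.mp h2

/-- **`r_an(W) ≠ 0 ⟹ L_p⁺(V, η, 0) = 0`** (same frame): `L(W,1) = 0` is the `k = 0` case of «every
derivative below the analytic rank vanishes» (`iteratedDeriv_entireLFunction_one_eq_zero`; `L(W,s)` entire by
`hmod`). [cite: Kobayashi2003, (3.6) (p. 7)] [cite: CremonaAlgorithms1997, §2.13 p. 37] -/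
theorem constantCoeff_eq_zero_of_analyticRank_ne_zero (hmod : hasEntireLFunction_rat) (hp2 : p ≠ 2)
    (W V : WeierstrassCurve ℚ) [W.IsElliptic] [W.IsGloballyMinimal] [V.IsElliptic] [V.IsGloballyMinimal]
    (C : VariableChange ℚ) (hCV : C • W.quadraticTwist ((-1) ^ (p / 2) * p) = V)
    (hgood : V.HasGoodReductionAtPrime p) (hf : IsNewformOf V f) {ϖ : ℚ}
    (hϖ : if Even (p / 2) then (ϖ : ℝ) * V.realPeriodRat = plusPeriod f
      else (ϖ : ℝ) * V.imaginaryPeriodRat = minusPeriod f)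
    {L : IwasawaAlgebra p} (hL : IsQuadraticBranchPlusLFunction f p ϖ L)
    (hr : W.analyticRank ≠ 0) : PowerSeries.constantCoeff L = 0 := by
  have hLW : W.entireLFunction 1 = 0 := by
    have h := iteratedDeriv_entireLFunction_one_eq_zero W (hmod W) (k := 0) (Nat.pos_of_ne_zero hr)
    rwa [iteratedDeriv_zero] at h
  exact constantCoeff_eq_zero_of_entireLFunction_one_eq_zero p hmod hp2 W V C hCV hgood hf hϖ hL hLW

end Value

/-! ## §3 The rank-`1` sub-cut re-read: the shape binder from one unit coefficient -/

section SubCut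

variable {p : ℕ} [hp : Fact p.Prime]

/-- **The v4 shape binder from the unit-coefficient binder.** On a pair `C • W^{(p*)} = V` (`V` globally
minimal, good at `p ≥ 5`) with `r_an(W) ≠ 0`: IF `coeff₁ Lη ∈ ℤ_p^×` for every plus `L`-function `Lη` of the
newform of `V` (displayed; PARI's `λ⁺ = 1, μ⁺ = 0`), THEN `(Lη) = (X)` for every such `Lη` — verbatim the
binder `hX` of `etaMC_rankOneRows_of_mu_eq_zero_of_span_eq_span_X` / `Sig.stub_etaMC_r1_mu`. §2 + §1.
Modularity displayed (`hmod`). [cite: Kobayashi2003, (3.6) (p. 7)] [cite: Washington1997, §7.1] -/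
theorem span_eq_span_X_of_analyticRank_ne_zero_of_isUnit_coeff_one (hmod : hasEntireLFunction_rat)
    (V : WeierstrassCurve ℚ) [V.IsElliptic] [V.IsGloballyMinimal] (W : WeierstrassCurve ℚ) [W.IsElliptic]
    [W.IsGloballyMinimal] (C : VariableChange ℚ) (p : ℕ) [hp : Fact p.Prime] (h5 : 5 ≤ p)
    (hCV : C • W.quadraticTwist ((-1) ^ (p / 2) * p) = V) (hgood : V.HasGoodReductionAtPrime p)
    (hr : W.analyticRank ≠ 0)
    (hcoef : ∀ {N : ℕ} [NeZero N] {f : CuspForm (Gamma0 N) 2}, IsNewformOf V f →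
      ∀ (ϖ : ℚ), (if Even (p / 2) then (ϖ : ℝ) * V.realPeriodRat = plusPeriod f
          else (ϖ : ℝ) * V.imaginaryPeriodRat = minusPeriod f) →
      ∀ (Lη : IwasawaAlgebra p), IsQuadraticBranchPlusLFunction f p ϖ Lη →
        IsUnit (PowerSeries.coeff 1 Lη)) :
    ∀ {N : ℕ} [NeZero N] {f : CuspForm (Gamma0 N) 2}, IsNewformOf V f →
      ∀ (ϖ : ℚ), (if Even (p / 2) then (ϖ : ℝ) * V.realPeriodRat = plusPeriod f
          else (ϖ : ℝ) * V.imaginaryPeriodRat = minusPeriod f) →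
      ∀ (Lη : IwasawaAlgebra p), IsQuadraticBranchPlusLFunction f p ϖ Lη →
        Ideal.span {Lη} = Ideal.span {(PowerSeries.X : IwasawaAlgebra p)} := by
  intro N _ f hf ϖ hϖ Lη hL
  have hp2 : p ≠ 2 := by omega
  exact span_eq_span_X_of_constantCoeff_eq_zero_of_isUnit_coeff_one
    (constantCoeff_eq_zero_of_analyticRank_ne_zero p hmod hp2 W V C hCV hgood hf hϖ hL hr) (hcoef hf ϖ hϖ Lη hL)

/-- **(C1⁺_η)(V,p) on the RANK-ONE rows FROM `μ = 0` AND ONE UNIT COEFFICIENT** (∀-form; seat g4's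
`etaMC_rankOneRows_of_mu_eq_zero_of_span_eq_span_X` with the shape binder `(L_p⁺(V,η,X)) = (X)` replaced by
«`coeff₁ L_p⁺(V,η,X) ∈ ℤ_p^×`», the vanishing `L_p⁺(V,η,0) = 0` being now a THEOREM from `r_an(W) = 1`). For
every pair `(V, p)`, `p ≥ 5`, `V` a globally minimal model of `W^{(p*)}` good at `p` with `a_p(V) = 0` and
`r_an(W) = 1`: IF `coeff₁ Lη` is a `p`-adic unit for every plus `L`-function at `η` of the newform of `V`
(displayed — PARI's `λ⁺ = 1`, `μ⁺ = 0`) and `μ(X⁺(V/K_∞)^η) = 0` (displayed — the open input of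
`stub_etaMC_r1_mu`), THEN `QuadraticBranchPlusEtaMainConjectureAt V p`. CONDITIONAL on the named facts `h22`,
`h41` (Kobayashi Thm. 2.2 / Thm. 4.1 rational clause at `η`), `hGZK` (`Sel_{p^∞}(W/ℚ)` infinite) and `hmod`.
Nothing booked. [cite: Kobayashi2003, §4 Even main conjecture and Thm. 4.1 (p. 8), (3.6) (p. 7)]
[cite: GreenbergVatsal2000, p. 2 (2)] [cite: GreenbergLNM1716, §4 Lemma 4.2 (p. 102)] -/
theorem etaMC_rankOneRows_of_mu_eq_zero_of_isUnit_coeff_one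
    (h22 : Kobayashi2003.thm22_etaSignedSelmerDual_finite_torsion)
    (h41 : Kobayashi2003.thm41_plusEtaCharIdeal_dvd) (hGZK : rank_eq_analyticRank_of_analyticRank_le_one)
    (hmod : hasEntireLFunction_rat) :
    ∀ (V : WeierstrassCurve ℚ) [V.IsElliptic] [V.IsGloballyMinimal] (W : WeierstrassCurve ℚ) [W.IsElliptic]
      [W.IsGloballyMinimal] (C : VariableChange ℚ) (p : ℕ) [Fact p.Prime],
      5 ≤ p → C • W.quadraticTwist ((-1) ^ (p / 2) * p) = V →
      V.HasGoodReductionAtPrime p → V.frobeniusTrace p = 0 → W.analyticRank = 1 →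
      (∀ {N : ℕ} [NeZero N] {f : CuspForm (Gamma0 N) 2}, IsNewformOf V f →
        ∀ (ϖ : ℚ), (if Even (p / 2) then (ϖ : ℝ) * V.realPeriodRat = plusPeriod f
            else (ϖ : ℝ) * V.imaginaryPeriodRat = minusPeriod f) →
        ∀ (Lη : IwasawaAlgebra p), IsQuadraticBranchPlusLFunction f p ϖ Lη →
          IsUnit (PowerSeries.coeff 1 Lη)) →
      (∀ (K₀ : Type) [Field K₀] [NumberField K₀] [IsCyclotomicExtension {p} ℚ K₀]
          [(galRange (K := ℚ) K₀).Normal] (ηq : absoluteGaloisGroup ℚ →* ℤˣ),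
          (∀ σ ∈ galRange (K := ℚ) K₀, ηq σ = 1) → ηq ≠ 1 →
        ∀ (κ : ZpExtension ℚ p) (γ : absoluteGaloisGroup ℚ),
          κ.IsCyclotomic → κ.IsTopGenerator γ → γ ∈ galRange (K := ℚ) K₀ →
        ∀ (D : EtaSignedSelmerDualData V κ K₀ ℚ_[p] ηq γ 1) (g : IwasawaAlgebra p),
          D.charIdeal = Ideal.span {g} → HasUnitContent g) →
      QuadraticBranchPlusEtaMainConjectureAt V p := by
  intro V _ _ W _ _ C p _ h5 hCV hgood hap h1 hcoef hμ
  exact etaMC_rankOneRows_of_mu_eq_zero_of_span_eq_span_X h22 h41 hGZK V W C p h5 hCV hgood hap h1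
    (span_eq_span_X_of_analyticRank_ne_zero_of_isUnit_coeff_one hmod V W C p h5 hCV hgood (by rw [h1]; omega)
      hcoef) hμ

end SubCut

end EtaPrimeRoad

end Summit.BirchSwinnertonDyer.BirchSwinnertonDyer.Theorems

end
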